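import Literature.NumberTheory.EllipticCurves.BSDShaProofs
import HarnessLib

/-!
# Two independent divisible classes of order `p` force `p⁴ ∣ #A` (the kernel side of a second-descent
# `NONEMPTY × 2` certificate; cell `b2b-bsdres`, CLASS-CLOSURE instrument B-1 `SEL3CT-ALT`, seat cc-eng-4)

HONEST FRAMING (cell `b2b-bsdres`, run/shared/lean/b2b/bsd-rank1-residual/, verbatim in every
file): the goal of the cell is to DELETE the COMBINATION-SHAPED residual classes of the
Birch–Swinnerton-Dyer formula for ALL analytic-rank `≤ 1` elliptic curves over `ℚ` — "full BSD
formula for every rank `≤ 1` curve in class `C`" assembled STRICTLY from published theorems — so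
that the rank-`≤ 1` remainder becomes exactly the CONSTRUCTION-SHAPED classes, which are TYPED
(missing-input `Prop`s), NOT attempted. This is not "finishing BSD". Class-free TOOL theorems (pure
finite-abelian-group algebra); they assert nothing about any curve; nothing booked; no mark moved.
THEOREMS ONLY (no definition, no named fact, no `sorry`).

## What this file does

The NONEMPTY direction of the second `p`-descent instrument B-1 (Creutz 2014; here `p = 3`, the
`#Ш_an = 81` rows of additive-p3's `B1-ASK-SHA81`, x10a′'s `210392t1 / 384400cx1`) returns, for the
two plane cubics of an `𝔽₃`-basis `η₁, η₂` of `Sel^(3)(E/ℚ) ≅ Ш(E/ℚ)[3]` (rank `0`, `E(ℚ)[3] = 0`),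
the verdict `NONEMPTY(witness)` = "`[η_k]` IS a `p`-th multiple" (in `Sel^(9)`, hence in `Ш`).  The
lane's binder-free reading is `81 ∣ #Sel^(9)(E/ℚ)` (SIZING-B1-ASK-SHA81 §2).  This file proves the
`Ш`-level companion, usable by consumers that want `81 ∣ #Ш(E/ℚ)` directly:

* `pow_four_dvd_card_of_two_divisible` (§1): in a finite abelian group, two elements `c₁, c₂` with
  `p • cᵢ = 0`, `c₁ ≠ 0`, `c₂ ∉ ℤ∙c₁`, each of the form `p • dᵢ`, force `p⁴ ∣ #A`
  (the subgroup `H = ⟨d₁, d₂⟩` maps onto `⟨c₁, c₂⟩` (order `p²`) under `p •` with kernel containing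
  `⟨c₁, c₂⟩`, so `p⁴ ∣ #H ∣ #A`);
* `WeierstrassCurve.pow_four_dvd_card_sha_of_two_divisible` (§2): the same for `A = Ш(E/K)` finite —
  `3⁴ = 81 ∣ #Ш` from two NONEMPTY witnesses on an `𝔽₃`-basis of `Ш[3]`. No Cassels–Tate input.

Certificate-shaped hypotheses (the classes, their independence, the divisibility witnesses) are
instantiated per row by a class team from instrument records under census-lead's tier label.
-/

open scoped Classical

namespace Summit.BirchSwinnertonDyer.Rank1Residual.SecondDescent

section Algebra

variable {A : Type*} [AddCommGroup A]

/-- The subgroup generated by two `p`-torsion elements `c₁ ≠ 0`, `c₂ ∉ ℤ∙c₁` inside a group whose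
`p`-torsion has order `p²` has order `p²`. -/
theorem card_closure_pair_eq_sq [Finite A] {p : ℕ} (hp : p.Prime)
    (hcard : Nat.card (AddSubgroup.torsionBy A (p : ℤ)) = p ^ 2) {c₁ c₂ : A} (h1 : p • c₁ = 0)
    (h2 : p • c₂ = 0) (hc₁ : c₁ ≠ 0) (hind : c₂ ∉ AddSubgroup.zmultiples c₁) :
    Nat.card (AddSubgroup.closure ({c₁, c₂} : Set A)) = p ^ 2 := by
  haveI : Fact p.Prime := ⟨hp⟩
  set H := AddSubgroup.closure ({c₁, c₂} : Set A) with hH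
  have hHT : H ≤ AddSubgroup.torsionBy A (p : ℤ) := by
    rw [hH, AddSubgroup.closure_le]
    intro a ha
    rcases ha with rfl | rfl
    · exact AddSubgroup.torsionBy.nsmul_iff.mpr h1
    · exact AddSubgroup.torsionBy.nsmul_iff.mpr h2
  have hc₁H : c₁ ∈ H := AddSubgroup.subset_closure (by simp)
  have hc₂H : c₂ ∈ H := AddSubgroup.subset_closure (by simp)
  have hZH : AddSubgroup.zmultiples c₁ ≤ H := AddSubgroup.zmultiples_le_of_mem hc₁H
  have hcardZ : Nat.card (AddSubgroup.zmultiples c₁) = p := by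
    rw [Nat.card_zmultiples, addOrderOf_eq_prime h1 hc₁]
  have hHdvd : Nat.card H ∣ p ^ 2 := hcard ▸ AddSubgroup.card_dvd_of_le hHT
  have hpH : p ∣ Nat.card H := hcardZ ▸ AddSubgroup.card_dvd_of_le hZH
  have hHne : Nat.card H ≠ p := by
    intro hH1
    have hEq : AddSubgroup.zmultiples c₁ = H :=
      AddSubgroup.eq_of_le_of_card_ge hZH (by rw [hH1, hcardZ])
    exact hind (hEq ▸ hc₂H)
  obtain ⟨i, hi2, hi⟩ := (Nat.dvd_prime_pow hp).mp hHdvd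
  interval_cases i
  · exfalso; rw [hi, pow_zero] at hpH; exact hp.one_lt.ne' (Nat.dvd_one.mp hpH)
  · exact absurd ((pow_one p).symm.trans hi.symm).symm hHne
  · exact hi

/-- **Main algebraic lemma (NONEMPTY × 2).** In a finite abelian group with `#A[p] = p²`, two
`p`-torsion elements `c₁ ≠ 0`, `c₂ ∉ ℤ∙c₁` that are BOTH `p`-th multiples (`cᵢ = p • dᵢ`) force
`p⁴ ∣ #A`. -/
theorem pow_four_dvd_card_of_two_divisible [Finite A] {p : ℕ} (hp : p.Prime)
    (hcard : Nat.card (AddSubgroup.torsionBy A (p : ℤ)) = p ^ 2) {c₁ c₂ d₁ d₂ : A}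
    (h1 : p • c₁ = 0) (h2 : p • c₂ = 0) (hc₁ : c₁ ≠ 0) (hind : c₂ ∉ AddSubgroup.zmultiples c₁)
    (hd₁ : p • d₁ = c₁) (hd₂ : p • d₂ = c₂) : p ^ 4 ∣ Nat.card A := by
  -- `H = ⟨d₁, d₂⟩`, the `p`-multiplication map on it, its kernel and range
  set H := AddSubgroup.closure ({d₁, d₂} : Set A) with hH
  have hd₁H : d₁ ∈ H := AddSubgroup.subset_closure (by simp)
  have hd₂H : d₂ ∈ H := AddSubgroup.subset_closure (by simp)
  have hc₁H : c₁ ∈ H := hd₁ ▸ H.nsmul_mem hd₁H p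
  have hc₂H : c₂ ∈ H := hd₂ ▸ H.nsmul_mem hd₂H p
  let f : H →+ H := nsmulAddMonoidHom p
  -- the pair subgroup `C = ⟨c₁, c₂⟩` (order `p²`) sits inside both `ker f` and `range f`
  have hCcard := card_closure_pair_eq_sq hp hcard h1 h2 hc₁ hind
  let C' : AddSubgroup H := AddSubgroup.closure ({⟨c₁, hc₁H⟩, ⟨c₂, hc₂H⟩} : Set H)
  have hC'card : Nat.card C' = p ^ 2 := by
    -- `C'` is the preimage picture of `C` inside `H`: compare via the injective subtype map
    have hmap : C'.map H.subtype = AddSubgroup.closure ({c₁, c₂} : Set A) := by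
      rw [AddMonoidHom.map_closure]
      congr 1
      ext a
      simp only [Set.image_insert_eq, Set.image_singleton, AddSubgroup.coe_subtype, Set.mem_insert_iff,
        Set.mem_singleton_iff]
    have hinj : Function.Injective H.subtype := H.subtype_injective
    rw [← hCcard, ← hmap]
    exact (AddSubgroup.card_map_of_injective hinj).symm
  have hC'ker : C' ≤ f.ker := by
    rw [AddSubgroup.closure_le]
    intro a ha
    rcases ha with rfl | rfl
    · simp [f, AddMonoidHom.mem_ker, nsmulAddMonoidHom, h1]
    · simp [f, AddMonoidHom.mem_ker, nsmulAddMonoidHom, h2]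
  have hC'range : C' ≤ f.range := by
    rw [AddSubgroup.closure_le]
    intro a ha
    rcases ha with rfl | rfl
    · exact ⟨⟨d₁, hd₁H⟩, by ext; simp [f, nsmulAddMonoidHom, hd₁]⟩
    · exact ⟨⟨d₂, hd₂H⟩, by ext; simp [f, nsmulAddMonoidHom, hd₂]⟩
  have hker : p ^ 2 ∣ Nat.card f.ker := hC'card ▸ AddSubgroup.card_dvd_of_le hC'ker
  have hrange : p ^ 2 ∣ Nat.card f.range := hC'card ▸ AddSubgroup.card_dvd_of_le hC'range
  -- `#H = #ker f · #range f`
  have hHeq : Nat.card H = Nat.card f.ker * Nat.card f.range := by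
    rw [AddSubgroup.card_eq_card_quotient_mul_card_addSubgroup f.ker,
      Nat.card_congr (QuotientAddGroup.quotientKerEquivRange f).toEquiv, mul_comm]
  have hH4 : p ^ 4 ∣ Nat.card H := by
    rw [hHeq, show p ^ 4 = p ^ 2 * p ^ 2 by ring]
    exact Nat.mul_dvd_mul hker hrange
  exact hH4.trans (AddSubgroup.card_addSubgroup_dvd_card H)

end Algebra

section Sha

open WeierstrassCurve

universe u

variable {K : Type u} [Field K] [NumberField K]

/-- **The B-1 `NONEMPTY × 2` reading, `Ш`-level kernel form.** For `E/K` with FINITE `Ш(E/K)` and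
`#Ш[p] = p²`: two classes `c₁ ≠ 0`, `c₂ ∉ ℤ∙c₁` of `Ш[p]` (an `𝔽_p`-basis, e.g. the images of an
EXACT `Sel^(p)` basis at rank `0`, `E(K)[p] = 0`) that are BOTH `p`-th multiples in `Ш` (= two
second-descent `NONEMPTY` witnesses, Creutz 2014) give `p⁴ ∣ #Ш(E/K)` — at `p = 3`: `81 ∣ #Ш`.
No Cassels–Tate input. Certificate-shaped hypotheses; nothing about any curve is asserted here. -/
theorem _root_.WeierstrassCurve.pow_four_dvd_card_sha_of_two_divisible (W : WeierstrassCurve K)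
    [W.IsElliptic] [Finite W.sha] {p : ℕ} (hp : p.Prime)
    (hcard : Nat.card (AddSubgroup.torsionBy W.sha (p : ℤ)) = p ^ 2) {c₁ c₂ d₁ d₂ : W.sha}
    (h1 : p • c₁ = 0) (h2 : p • c₂ = 0) (hc₁ : c₁ ≠ 0) (hind : c₂ ∉ AddSubgroup.zmultiples c₁)
    (hd₁ : p • d₁ = c₁) (hd₂ : p • d₂ = c₂) : p ^ 4 ∣ Nat.card W.sha :=
  pow_four_dvd_card_of_two_divisible hp hcard h1 h2 hc₁ hind hd₁ hd₂

end Sha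


/-! ## Appendix (cc-eng-4 GEN 11, 2026-08-21): the `#A[p] = p²` hypothesis is NOT needed

In §1–§2 the hypothesis `hcard : #A[p] = p²` enters only through `card_closure_pair_eq_sq`
(`#⟨c₁, c₂⟩ = p²`).  But two `p`-torsion elements `c₁ ≠ 0`, `c₂ ∉ ℤ∙c₁` of an abelian group ALWAYS
generate a subgroup of order `p²` (`ℤ∙c₁ ⊓ ℤ∙c₂` is a proper subgroup of the order-`p` group `ℤ∙c₂`,
hence trivial, so `#(ℤ∙c₁ ⊔ ℤ∙c₂) = p · p`).  The primed theorems below are the `hcard`-FREE forms of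
`card_closure_pair_eq_sq`, `pow_four_dvd_card_of_two_divisible` and
`WeierstrassCurve.pow_four_dvd_card_sha_of_two_divisible`.  CONSEQUENCE for the B-1 `NONEMPTY × 2`
chain: a record no longer needs `#Ш[3] = 9` (i.e. no EXACT upper bound on `dim Sel₃` — the
class-group-certification-bound step); its certificate-shaped binders are exactly the two witnesses
(`cᵢ` nonzero / independent `3`-torsion classes of `Ш`, each a third multiple).  Appended; the
decls above are byte-identical; class-free TOOL theorems; nothing about any curve is asserted.
-/

section AlgebraFree

variable {A : Type*} [AddCommGroup A]

/-- **`#⟨c₁, c₂⟩ = p²` with NO hypothesis on `#A[p]`** (`hcard`-free form of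
`card_closure_pair_eq_sq`): two `p`-torsion elements `c₁ ≠ 0`, `c₂ ∉ ℤ∙c₁` of a finite abelian group
generate a subgroup of order `p²` — `⟨c₁, c₂⟩ = ℤ∙c₁ ⊔ ℤ∙c₂`, `ℤ∙c₁ ⊓ ℤ∙c₂ = ⊥` (a proper subgroup of
the order-`p` group `ℤ∙c₂`), and `#(ℤ∙c₁ ⊔ ℤ∙c₂) = #ℤ∙c₁ · [ℤ∙c₁ ⊔ ℤ∙c₂ : ℤ∙c₁] = p · #ℤ∙c₂`.
Class-free; cc-eng-4 GEN 11. -/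
theorem card_closure_pair_eq_sq' [Finite A] {p : ℕ} (hp : p.Prime) {c₁ c₂ : A} (h1 : p • c₁ = 0)
    (h2 : p • c₂ = 0) (hc₁ : c₁ ≠ 0) (hind : c₂ ∉ AddSubgroup.zmultiples c₁) :
    Nat.card (AddSubgroup.closure ({c₁, c₂} : Set A)) = p ^ 2 := by
  haveI : Fact p.Prime := ⟨hp⟩
  set Z₁ := AddSubgroup.zmultiples c₁ with hZ₁
  set Z₂ := AddSubgroup.zmultiples c₂ with hZ₂
  have hc₂ : c₂ ≠ 0 := by
    rintro rfl
    exact hind (zero_mem _)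
  have hcard₁ : Nat.card Z₁ = p := by rw [hZ₁, Nat.card_zmultiples, addOrderOf_eq_prime h1 hc₁]
  have hcard₂ : Nat.card Z₂ = p := by rw [hZ₂, Nat.card_zmultiples, addOrderOf_eq_prime h2 hc₂]
  -- `⟨c₁, c₂⟩ = ℤ∙c₁ ⊔ ℤ∙c₂`
  have hsup : AddSubgroup.closure ({c₁, c₂} : Set A) = Z₁ ⊔ Z₂ := by
    rw [hZ₁, hZ₂, AddSubgroup.zmultiples_eq_closure, AddSubgroup.zmultiples_eq_closure,
      ← AddSubgroup.closure_union, Set.singleton_union]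
  -- `ℤ∙c₁ ⊓ ℤ∙c₂ = ⊥`: its order divides `#ℤ∙c₂ = p` and is not `p` (else `c₂ ∈ ℤ∙c₁`)
  have hinf : Z₁ ⊓ Z₂ = ⊥ := by
    have hdvd : Nat.card (Z₁ ⊓ Z₂ : AddSubgroup A) ∣ p :=
      hcard₂ ▸ AddSubgroup.card_dvd_of_le inf_le_right
    rcases (Nat.dvd_prime hp).mp hdvd with h | h
    · exact AddSubgroup.eq_bot_of_card_eq _ h
    · exfalso
      have hEq : Z₁ ⊓ Z₂ = Z₂ :=
        AddSubgroup.eq_of_le_of_card_ge inf_le_right (by rw [h, hcard₂])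
      have hle : Z₂ ≤ Z₁ := hEq ▸ inf_le_left
      exact hind (hle (AddSubgroup.mem_zmultiples c₂))
  -- `[ℤ∙c₁ ⊔ ℤ∙c₂ : ℤ∙c₁] = [ℤ∙c₂ : ℤ∙c₁ ⊓ ℤ∙c₂] = #ℤ∙c₂ = p`
  have hrel : Z₁.relIndex (Z₁ ⊔ Z₂) = p := by
    rw [AddSubgroup.relIndex_sup_left, ← AddSubgroup.inf_relIndex_right Z₁ Z₂, hinf,
      AddSubgroup.relIndex_bot_left, hcard₂]
  -- `#ℤ∙c₁ · [ℤ∙c₁ ⊔ ℤ∙c₂ : ℤ∙c₁] = #(ℤ∙c₁ ⊔ ℤ∙c₂)`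
  have hmul : Nat.card Z₁ * Z₁.relIndex (Z₁ ⊔ Z₂) = Nat.card (Z₁ ⊔ Z₂ : AddSubgroup A) := by
    have h := AddSubgroup.relIndex_mul_relIndex (⊥ : AddSubgroup A) Z₁ (Z₁ ⊔ Z₂) bot_le le_sup_left
    rwa [AddSubgroup.relIndex_bot_left, AddSubgroup.relIndex_bot_left] at h
  rw [hsup, ← hmul, hrel, hcard₁, sq]

/-- **Main algebraic lemma (NONEMPTY × 2), `hcard`-FREE.** In a finite abelian group, two
`p`-torsion elements `c₁ ≠ 0`, `c₂ ∉ ℤ∙c₁` that are BOTH `p`-th multiples (`cᵢ = p • dᵢ`) force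
`p⁴ ∣ #A` — NO hypothesis on `#A[p]` (cf. `pow_four_dvd_card_of_two_divisible`): `H = ⟨d₁, d₂⟩` maps
onto `⟨c₁, c₂⟩` (order `p²`, `card_closure_pair_eq_sq'`) under `p •` with kernel containing
`⟨c₁, c₂⟩`, so `p⁴ ∣ #H ∣ #A`. Class-free; cc-eng-4 GEN 11. -/
theorem pow_four_dvd_card_of_two_divisible' [Finite A] {p : ℕ} (hp : p.Prime) {c₁ c₂ d₁ d₂ : A}
    (h1 : p • c₁ = 0) (h2 : p • c₂ = 0) (hc₁ : c₁ ≠ 0) (hind : c₂ ∉ AddSubgroup.zmultiples c₁)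
    (hd₁ : p • d₁ = c₁) (hd₂ : p • d₂ = c₂) : p ^ 4 ∣ Nat.card A := by
  -- `H = ⟨d₁, d₂⟩`, the `p`-multiplication map on it, its kernel and range
  set H := AddSubgroup.closure ({d₁, d₂} : Set A) with hH
  have hd₁H : d₁ ∈ H := AddSubgroup.subset_closure (by simp)
  have hd₂H : d₂ ∈ H := AddSubgroup.subset_closure (by simp)
  have hc₁H : c₁ ∈ H := hd₁ ▸ H.nsmul_mem hd₁H p
  have hc₂H : c₂ ∈ H := hd₂ ▸ H.nsmul_mem hd₂H p
  let f : H →+ H := nsmulAddMonoidHom p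
  -- the pair subgroup `C = ⟨c₁, c₂⟩` (order `p²`, NO `hcard`) sits inside both `ker f` and `range f`
  have hCcard := card_closure_pair_eq_sq' hp h1 h2 hc₁ hind
  let C' : AddSubgroup H := AddSubgroup.closure ({⟨c₁, hc₁H⟩, ⟨c₂, hc₂H⟩} : Set H)
  have hC'card : Nat.card C' = p ^ 2 := by
    have hmap : C'.map H.subtype = AddSubgroup.closure ({c₁, c₂} : Set A) := by
      rw [AddMonoidHom.map_closure]
      congr 1
      ext a
      simp only [Set.image_insert_eq, Set.image_singleton, AddSubgroup.coe_subtype, Set.mem_insert_iff,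
        Set.mem_singleton_iff]
    have hinj : Function.Injective H.subtype := H.subtype_injective
    rw [← hCcard, ← hmap]
    exact (AddSubgroup.card_map_of_injective hinj).symm
  have hC'ker : C' ≤ f.ker := by
    rw [AddSubgroup.closure_le]
    intro a ha
    rcases ha with rfl | rfl
    · simp [f, AddMonoidHom.mem_ker, nsmulAddMonoidHom, h1]
    · simp [f, AddMonoidHom.mem_ker, nsmulAddMonoidHom, h2]
  have hC'range : C' ≤ f.range := by
    rw [AddSubgroup.closure_le]
    intro a ha
    rcases ha with rfl | rfl
    · exact ⟨⟨d₁, hd₁H⟩, by ext; simp [f, nsmulAddMonoidHom, hd₁]⟩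
    · exact ⟨⟨d₂, hd₂H⟩, by ext; simp [f, nsmulAddMonoidHom, hd₂]⟩
  have hker : p ^ 2 ∣ Nat.card f.ker := hC'card ▸ AddSubgroup.card_dvd_of_le hC'ker
  have hrange : p ^ 2 ∣ Nat.card f.range := hC'card ▸ AddSubgroup.card_dvd_of_le hC'range
  -- `#H = #ker f · #range f`
  have hHeq : Nat.card H = Nat.card f.ker * Nat.card f.range := by
    rw [AddSubgroup.card_eq_card_quotient_mul_card_addSubgroup f.ker,
      Nat.card_congr (QuotientAddGroup.quotientKerEquivRange f).toEquiv, mul_comm]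
  have hH4 : p ^ 4 ∣ Nat.card H := by
    rw [hHeq, show p ^ 4 = p ^ 2 * p ^ 2 by ring]
    exact Nat.mul_dvd_mul hker hrange
  exact hH4.trans (AddSubgroup.card_addSubgroup_dvd_card H)

/-- With `#A[p] = p²` available, the `hcard`-free lemma recovers `pow_four_dvd_card_of_two_divisible`
(consistency check; the hypothesis is simply discarded). Class-free; cc-eng-4 GEN 11. -/
theorem pow_four_dvd_card_of_two_divisible_of_card [Finite A] {p : ℕ} (hp : p.Prime)
    (_hcard : Nat.card (AddSubgroup.torsionBy A (p : ℤ)) = p ^ 2) {c₁ c₂ d₁ d₂ : A}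
    (h1 : p • c₁ = 0) (h2 : p • c₂ = 0) (hc₁ : c₁ ≠ 0) (hind : c₂ ∉ AddSubgroup.zmultiples c₁)
    (hd₁ : p • d₁ = c₁) (hd₂ : p • d₂ = c₂) : p ^ 4 ∣ Nat.card A :=
  pow_four_dvd_card_of_two_divisible' hp h1 h2 hc₁ hind hd₁ hd₂

end AlgebraFree

section ShaFree

open WeierstrassCurve

universe u

variable {K : Type u} [Field K] [NumberField K]

/-- **The B-1 `NONEMPTY × 2` reading, `Ш`-level kernel form, `hcard`-FREE.** For `E/K` with FINITE
`Ш(E/K)`: two classes `c₁ ≠ 0`, `c₂ ∉ ℤ∙c₁` with `p • cᵢ = 0` that are BOTH `p`-th multiples in `Ш`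
(= two second-descent `NONEMPTY` witnesses, Creutz 2014) give `p⁴ ∣ #Ш(E/K)` — at `p = 3`:
`81 ∣ #Ш` — with NO hypothesis on `#Ш[p]` (cf. `pow_four_dvd_card_sha_of_two_divisible`). No
Cassels–Tate input. Certificate-shaped hypotheses; nothing about any curve is asserted here.
cc-eng-4 GEN 11. [cite: Creutz2014, §1] -/
theorem _root_.WeierstrassCurve.pow_four_dvd_card_sha_of_two_divisible' (W : WeierstrassCurve K)
    [W.IsElliptic] [Finite W.sha] {p : ℕ} (hp : p.Prime) {c₁ c₂ d₁ d₂ : W.sha}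
    (h1 : p • c₁ = 0) (h2 : p • c₂ = 0) (hc₁ : c₁ ≠ 0) (hind : c₂ ∉ AddSubgroup.zmultiples c₁)
    (hd₁ : p • d₁ = c₁) (hd₂ : p • d₂ = c₂) : p ^ 4 ∣ Nat.card W.sha :=
  pow_four_dvd_card_of_two_divisible' hp h1 h2 hc₁ hind hd₁ hd₂

end ShaFree


/-! ## Appendix B (cc-eng-4 GEN 11, 2026-08-21): ONE divisible class suffices for `p³ ∣ #A`

The second refinement of the NONEMPTY reading.  If only ONE of the two independent `p`-torsion
classes is known to be a `p`-th multiple — `c₁ = p • d` with `c₁ ≠ 0`, `c₂ ∉ ℤ∙c₁`, `p • c₂ = 0` —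
then already `p³ ∣ #A`: `ℤ∙d` has order `p²` (`p • d = c₁ ≠ 0`, `p² • d = p • c₁ = 0`) and meets
`ℤ∙c₂` trivially (an element of `ℤ∙d` killed by `p` is a multiple of `p • d = c₁`, and `c₂ ∉ ℤ∙c₁`),
so `#(ℤ∙d ⊔ ℤ∙c₂) = p² · p`.  For `A = Ш(E/K)` with the Cassels–Tate alternating pairing, `p³ ∣ #Ш`
is exactly the input of the tree's parity step `Typed.missingLowerBoundAt_of_casselsTate_of_pow_dvd`
(`k = 2`: `p^(2k-1) ∣ #Ш`), so a B-1 record needs ONE second-descent `NONEMPTY` witness (on either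
cubic of an independent `Sel₃` pair), not two — the consumers are in
`BSDpFromSecondDescentNonempty.lean` Appendix B.  Class-free TOOL theorems; nothing about any curve
is asserted.
-/

section OneDivisible

variable {A : Type*} [AddCommGroup A]

/-- **`p³ ∣ #A` from ONE divisible class of an independent `p`-torsion pair.** In a finite abelian
group, `p`-torsion elements `c₁ ≠ 0`, `c₂ ∉ ℤ∙c₁` with `c₁ = p • d` a `p`-th multiple force
`p³ ∣ #A` — NO hypothesis on `#A[p]`, NO divisibility of `c₂`: `#ℤ∙d = p²`, `ℤ∙d ⊓ ℤ∙c₂ = ⊥`, so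
`#(ℤ∙d ⊔ ℤ∙c₂) = p³`. Class-free; cc-eng-4 GEN 11. -/
theorem pow_three_dvd_card_of_divisible_of_not_mem [Finite A] {p : ℕ} (hp : p.Prime) {c₁ c₂ d : A}
    (h1 : p • c₁ = 0) (h2 : p • c₂ = 0) (hc₁ : c₁ ≠ 0) (hind : c₂ ∉ AddSubgroup.zmultiples c₁)
    (hd : p • d = c₁) : p ^ 3 ∣ Nat.card A := by
  haveI : Fact p.Prime := ⟨hp⟩
  set Zd := AddSubgroup.zmultiples d with hZd
  set Z₂ := AddSubgroup.zmultiples c₂ with hZ₂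
  have hc₂ : c₂ ≠ 0 := by
    rintro rfl
    exact hind (zero_mem _)
  -- `addOrderOf d = p²`
  have hnot : ¬ p ^ 1 • d = 0 := by rw [pow_one, hd]; exact hc₁
  have hfin : p ^ (1 + 1) • d = 0 := by
    rw [show p ^ (1 + 1) = p * p by ring, ← smul_smul, hd, h1]
  have hod : addOrderOf d = p ^ 2 := addOrderOf_eq_prime_pow hnot hfin
  have hcardd : Nat.card Zd = p ^ 2 := by rw [hZd, Nat.card_zmultiples, hod]
  have hcard₂ : Nat.card Z₂ = p := by rw [hZ₂, Nat.card_zmultiples, addOrderOf_eq_prime h2 hc₂]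
  -- `ℤ∙d ⊓ ℤ∙c₂ = ⊥`: else `c₂ ∈ ℤ∙d`, `c₂ = k • d` with `p • c₂ = 0` ⇒ `p² ∣ p k` ⇒ `c₂ ∈ ℤ∙(p • d) = ℤ∙c₁`
  have hinf : Zd ⊓ Z₂ = ⊥ := by
    have hdvd : Nat.card (Zd ⊓ Z₂ : AddSubgroup A) ∣ p :=
      hcard₂ ▸ AddSubgroup.card_dvd_of_le inf_le_right
    rcases (Nat.dvd_prime hp).mp hdvd with h | h
    · exact AddSubgroup.eq_bot_of_card_eq _ h
    · exfalso
      have hEq : Zd ⊓ Z₂ = Z₂ :=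
        AddSubgroup.eq_of_le_of_card_ge inf_le_right (by rw [h, hcard₂])
      have hle : Z₂ ≤ Zd := hEq ▸ inf_le_left
      have hmem : c₂ ∈ Zd := hle (AddSubgroup.mem_zmultiples c₂)
      obtain ⟨k, hk⟩ := AddSubgroup.mem_zmultiples_iff.mp hmem
      have hp0 : (p : ℤ) ≠ 0 := by exact_mod_cast hp.ne_zero
      have hz : ((p : ℤ) * k) • d = 0 := by rw [← smul_smul, hk, natCast_zsmul, h2]
      have hdiv : (addOrderOf d : ℤ) ∣ (p : ℤ) * k := (addOrderOf_dvd_iff_zsmul_eq_zero).mpr hz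
      rw [hod, Nat.cast_pow, sq] at hdiv
      obtain ⟨m, rfl⟩ := (mul_dvd_mul_iff_left hp0).mp hdiv
      refine hind (AddSubgroup.mem_zmultiples_iff.mpr ⟨m, ?_⟩)
      rw [← hk, ← hd, ← natCast_zsmul, smul_smul, mul_comm]
  -- `[ℤ∙d ⊔ ℤ∙c₂ : ℤ∙d] = [ℤ∙c₂ : ℤ∙d ⊓ ℤ∙c₂] = #ℤ∙c₂ = p`
  have hrel : Zd.relIndex (Zd ⊔ Z₂) = p := by
    rw [AddSubgroup.relIndex_sup_left, ← AddSubgroup.inf_relIndex_right Zd Z₂, hinf,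
      AddSubgroup.relIndex_bot_left, hcard₂]
  have hmul : Nat.card Zd * Zd.relIndex (Zd ⊔ Z₂) = Nat.card (Zd ⊔ Z₂ : AddSubgroup A) := by
    have h := AddSubgroup.relIndex_mul_relIndex (⊥ : AddSubgroup A) Zd (Zd ⊔ Z₂) bot_le le_sup_left
    rwa [AddSubgroup.relIndex_bot_left, AddSubgroup.relIndex_bot_left] at h
  have hH : Nat.card (Zd ⊔ Z₂ : AddSubgroup A) = p ^ 3 := by
    rw [← hmul, hrel, hcardd]; ring
  exact hH ▸ AddSubgroup.card_addSubgroup_dvd_card (Zd ⊔ Z₂)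

end OneDivisible

section ShaOneDivisible

open WeierstrassCurve

universe u

variable {K : Type u} [Field K] [NumberField K]

/-- **The B-1 `NONEMPTY × 1` reading, `Ш`-level kernel form.** For `E/K` with FINITE `Ш(E/K)`:
two classes `c₁ ≠ 0`, `c₂ ∉ ℤ∙c₁` with `p • cᵢ = 0` (e.g. the images of two independent `Sel^(p)`
elements at rank `0`, `E(K)[p] = 0`) of which ONE, `c₁`, is a `p`-th multiple in `Ш` (= one
second-descent `NONEMPTY` witness, Creutz 2014) give `p³ ∣ #Ш(E/K)`; with the Cassels–Tate
alternating pairing this becomes `p⁴ ∣ #Ш` downstream (`Typed.missingLowerBoundAt_of_casselsTate_of_pow_dvd`,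
`k = 2`). NO hypothesis on `#Ш[p]`. Certificate-shaped hypotheses; nothing about any curve is
asserted here. cc-eng-4 GEN 11. [cite: Creutz2014, §1] -/
theorem _root_.WeierstrassCurve.pow_three_dvd_card_sha_of_divisible_of_not_mem
    (W : WeierstrassCurve K) [W.IsElliptic] [Finite W.sha] {p : ℕ} (hp : p.Prime) {c₁ c₂ d : W.sha}
    (h1 : p • c₁ = 0) (h2 : p • c₂ = 0) (hc₁ : c₁ ≠ 0) (hind : c₂ ∉ AddSubgroup.zmultiples c₁)
    (hd : p • d = c₁) : p ^ 3 ∣ Nat.card W.sha :=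
  pow_three_dvd_card_of_divisible_of_not_mem hp h1 h2 hc₁ hind hd

end ShaOneDivisible

end Summit.BirchSwinnertonDyer.Rank1Residual.SecondDescent
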